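import Literature.Analysis.ODE.CompactSupportFlow
import Mathlib.Analysis.Calculus.BumpFunction.FiniteDimension
import HarnessLib

/-!
# Smooth dependence of global flows on parameters

Topic `Literature/Analysis/ODE`; sequel to `CompactSupportFlow.lean` (`Literature.Analysis.ODE.globalFlow`:
the global flow of a bounded, globally Lipschitz vector field on a Banach space, jointly `C^n` in
the initial point and time for a `C^n` field, `n ≥ 1`).

**Theorem** (`Literature.Analysis.ODE.contDiff_parametric_globalFlow`; Lang, *Differential and
Riemannian Manifolds* (1995), Ch. IV §1, Thm. 1.16 with the Remark following it, "dependence on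
parameters": *"a vector field depending on parameters … can be viewed as a vector field on the
product … the flow then depends [`C^p`] on the parameters"*; Hartman, *Ordinary Differential
Equations* (2002), Ch. V, Thm. 4.1 and its Cor. 4.1). Let `Y : W → F → F` be a family of vector
fields on the Banach space `F`, parametrised by a finite-dimensional real normed space `W`, such
that `(w, q) ↦ Y w q` is `C^n` (`n ≥ 1`), every `Y w` is bounded and globally Lipschitz (so that its
global flow `Φ^w` is defined), and, locally in the parameter, `(w, q) ↦ Y w q` is Lipschitz and
bounded uniformly in `q`. Then `(w, q, t) ↦ Φ^w_t (q)` is `C^n` jointly in the parameter, the point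
and the time.

Proof (Lang's device, localised in the parameter). Joint smoothness is a local statement. Near a
parameter `w₀`, replace `Y` by `Ỹ w := Y (r w)`, where `r w = w₀ + ψ(w) (w - w₀)` for a smooth bump
`ψ` equal to `1` near `w₀` and supported in the small ball on which `Y` is uniformly Lipschitz and
bounded: `r` is smooth, globally Lipschitz, equal to the identity near `w₀`, with values in that
ball. The *suspended* autonomous field `Z (q, w) = (Ỹ w q, 0)` on `F × W` is then `C^n`, bounded and
globally Lipschitz, so its global flow `Λ` is jointly `C^n` (`contDiff_globalFlow`); and by uniqueness
of integral curves `Λ_t (q, w) = (Φ^w_t q, w)` whenever `r w = w`, in particular for `w` near `w₀`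
(`globalFlow_suspension_eq`). Everything here is proved; no definitions, no named facts.

## References

* S. Lang, *Differential and Riemannian Manifolds*, GTM 160, Springer (1995), Ch. IV §1,
  Thm. 1.16 and the Remark on parameters. [Lang1995]
* P. Hartman, *Ordinary Differential Equations*, Classics in Applied Mathematics 38, SIAM (2002),
  Ch. V, Thm. 4.1, Cor. 4.1. [Hartman2002]
-/

noncomputable section

open Set Metric Filter Topology Function
open scoped ContDiff NNReal

namespace Literature.Analysis.ODE

universe u v

variable {F : Type u} [NormedAddCommGroup F] [NormedSpace ℝ F] [CompleteSpace F]
variable {W : Type v} [NormedAddCommGroup W] [NormedSpace ℝ W]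

/-! ### The suspension of a parametrised field -/

/-- **The flow of a suspended parametrised field.** Let `Z (q, w) = (Y' w q, 0)` be the suspension
on `F × W` of a family of fields `Y'`, globally Lipschitz and bounded, and let `w` be a parameter at
which `Y' w = X` for a bounded Lipschitz field `X` on `F`. Then the flow of `Z` through `(q, w)` is
`t ↦ (Φ^X_t q, w)`: the parameter is a first integral and the `F`-component is the flow of the
slice (uniqueness of integral curves). [cite: Lang1995, Ch. IV §1, Remark after Thm. 1.16] -/
theorem globalFlow_suspension_eq [CompleteSpace W] {Y' : W → F → F} {KZ : ℝ≥0} {BZ : ℝ}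
    (hZK : LipschitzWith KZ fun p : F × W => ((Y' p.2 p.1, (0 : W)) : F × W))
    (hZB : ∀ p : F × W, ‖((Y' p.2 p.1, (0 : W)) : F × W)‖ ≤ BZ)
    {w : W} {X : F → F} {K : ℝ≥0} {B : ℝ} (hK : LipschitzWith K X) (hB : ∀ q, ‖X q‖ ≤ B)
    (hw : Y' w = X) (q : F) (t : ℝ) :
    globalFlow hZK hZB (q, w) t = (globalFlow hK hB q t, w) := by
  subst hw
  have ht : t ∈ Ioo (-(|t| + 1)) (|t| + 1) := by
    constructor <;> cases abs_cases t <;> linarith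
  have key := eqOn_globalFlow hZK hZB (γ := fun s : ℝ => ((globalFlow hK hB q s, w) : F × W))
    (a := -(|t| + 1)) (b := |t| + 1) ⟨by linarith [abs_nonneg t], by linarith [abs_nonneg t]⟩
    (fun s _ => (hasDerivAt_globalFlow hK hB q s).prodMk (hasDerivAt_const s w))
  have := key ht
  simp only [globalFlow_zero] at this
  exact this.symm

/-! ### A smooth Lipschitz modification of the parameter, equal to the identity near a point -/

/-- **Smooth localisation of the parameter.** In a finite-dimensional real normed space, for every
point `w₀` and radius `ε > 0` there is a smooth, globally Lipschitz map `r : W → W` with values in the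
ball `B(w₀, ε)` and equal to the identity on a neighbourhood of `w₀` (namely
`r w = w₀ + ψ(w) (w - w₀)` for a smooth bump `ψ`). [folklore] -/
theorem exists_smooth_lipschitz_localisation [FiniteDimensional ℝ W] (w₀ : W) {ε : ℝ} (hε : 0 < ε) :
    ∃ r : W → W, ContDiff ℝ ∞ r ∧ (∃ C : ℝ≥0, LipschitzWith C r) ∧ (∀ w, r w ∈ ball w₀ ε) ∧
      ∀ w ∈ closedBall w₀ (ε / 4), r w = w := by
  let ψ : ContDiffBump w₀ := ⟨ε / 4, ε / 2, by positivity, by linarith⟩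
  set g : W → W := fun w => (ψ : W → ℝ) w • (w - w₀) with hg
  have hgs : ContDiff ℝ ∞ g := (ψ.contDiff (n := ⊤)).smul (contDiff_id.sub contDiff_const)
  have hgsupp : HasCompactSupport g := by
    refine ψ.hasCompactSupport.mono ?_
    intro w hw
    rw [mem_support] at hw ⊢
    contrapose! hw
    simp only [hg, hw, zero_smul]
  obtain ⟨C, hC⟩ := hgs.lipschitzWith_of_hasCompactSupport hgsupp (by simp)
  refine ⟨fun w => w₀ + g w, contDiff_const.add hgs, ⟨C, ?_⟩, fun w => ?_, fun w hw => ?_⟩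
  · exact LipschitzWith.of_dist_le_mul fun w w' => by
      rw [dist_eq_norm, add_sub_add_left_eq_sub, ← dist_eq_norm]
      exact hC.dist_le_mul w w'
  · rw [mem_ball, dist_eq_norm, add_sub_cancel_left, hg, norm_smul, Real.norm_of_nonneg ψ.nonneg]
    by_cases hw : w ∈ ball w₀ (ε / 2)
    · rw [mem_ball, dist_eq_norm] at hw
      calc (ψ : W → ℝ) w * ‖w - w₀‖ ≤ 1 * ‖w - w₀‖ :=
            mul_le_mul_of_nonneg_right ψ.le_one (norm_nonneg _)
        _ < ε := by linarith
    · have h0 : (ψ : W → ℝ) w = 0 := by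
        have : w ∉ Function.support (ψ : W → ℝ) := by rw [ψ.support_eq]; exact hw
        simpa [mem_support] using this
      rw [h0, zero_mul]; exact hε
  · have h1 : (ψ : W → ℝ) w = 1 := ψ.one_of_mem_closedBall hw
    simp only [hg, h1, one_smul, add_sub_cancel]

/-! ### Smooth dependence on parameters -/

/-- **Smooth dependence of the global flow on parameters** (Lang (1995), Ch. IV §1, Thm. 1.16 and
the Remark on parameters; Hartman (2002), Ch. V, Thm. 4.1, Cor. 4.1). Let `Y : W → F → F` be `C^n`
jointly (`n ≥ 1`), each `Y w` globally Lipschitz and bounded, and suppose that near every parameter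
`w₀` the map `(w, q) ↦ Y w q` is Lipschitz on `B(w₀, ε) × F` and bounded there. Then
`(w, q, t) ↦ Φ^{Y w}_t (q)` is `C^n`. [cite: Lang1995, Ch. IV §1, Thm. 1.16] -/
theorem contDiff_parametric_globalFlow [FiniteDimensional ℝ W] {Y : W → F → F} {n : ℕ∞}
    (hY : ContDiff ℝ n fun p : W × F => Y p.1 p.2) (hn : 1 ≤ n)
    {K : W → ℝ≥0} (hK : ∀ w, LipschitzWith (K w) (Y w)) {B : W → ℝ} (hB : ∀ w q, ‖Y w q‖ ≤ B w)
    (hloc : ∀ w₀ : W, ∃ ε : ℝ, 0 < ε ∧ (∃ L : ℝ≥0, LipschitzOnWith L (fun p : W × F => Y p.1 p.2)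
      (ball w₀ ε ×ˢ univ)) ∧ ∃ C : ℝ, ∀ w ∈ ball w₀ ε, ∀ q, ‖Y w q‖ ≤ C) :
    ContDiff ℝ n fun p : W × F × ℝ => globalFlow (hK p.1) (hB p.1) p.2.1 p.2.2 := by
  haveI : CompleteSpace W := FiniteDimensional.complete ℝ W
  refine contDiff_iff_contDiffAt.2 fun p₀ => ?_
  obtain ⟨ε, hε, ⟨L, hL⟩, C, hC⟩ := hloc p₀.1
  obtain ⟨r, hr, ⟨Cr, hCr⟩, hrball, hrid⟩ := exists_smooth_lipschitz_localisation p₀.1 hε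
  -- the suspended, localised field `Z (q, w) = (Y (r w) q, 0)`
  have hZs : ContDiff ℝ n fun p : F × W => ((Y (r p.2) p.1, (0 : W)) : F × W) := by
    refine ContDiff.prodMk ?_ contDiff_const
    exact hY.comp (((hr.of_le (by exact_mod_cast le_top)).comp contDiff_snd).prodMk contDiff_fst)
  have hZB : ∀ p : F × W, ‖((Y (r p.2) p.1, (0 : W)) : F × W)‖ ≤ max C 0 := by
    intro p
    rw [Prod.norm_mk, norm_zero]
    exact max_le_max (hC _ (hrball p.2) p.1) le_rfl
  obtain ⟨Km, hm⟩ : ∃ Km : ℝ≥0, LipschitzWith Km fun p : F × W => ((r p.2, p.1) : W × F) :=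
    ⟨_, (hCr.comp LipschitzWith.prod_snd).prodMk LipschitzWith.prod_fst⟩
  have hmaps : MapsTo (fun p : F × W => ((r p.2, p.1) : W × F)) univ (ball p₀.1 ε ×ˢ univ) :=
    fun p _ => ⟨hrball p.2, mem_univ _⟩
  obtain ⟨KZ, hZK⟩ : ∃ KZ : ℝ≥0, LipschitzWith KZ fun p : F × W => ((Y (r p.2) p.1, (0 : W)) : F × W) := by
    have h1 : LipschitzWith (L * Km) fun p : F × W => Y (r p.2) p.1 := by
      have := hL.comp hm.lipschitzOnWith hmaps
      exact lipschitzOnWith_univ.1 this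
    exact ⟨_, h1.prodMk (LipschitzWith.const (0 : W))⟩
  -- its flow is jointly `C^n`
  have hΛ : ContDiff ℝ n fun p : (F × W) × ℝ => globalFlow hZK hZB p.1 p.2 :=
    contDiff_globalFlow hZs hn hZK hZB
  -- and computes the parametrised flow near `p₀`
  have hev : (fun p : W × F × ℝ => globalFlow (hK p.1) (hB p.1) p.2.1 p.2.2) =ᶠ[𝓝 p₀]
      fun p : W × F × ℝ => (globalFlow hZK hZB (p.2.1, p.1) p.2.2).1 := by
    have hnhds : {p : W × F × ℝ | p.1 ∈ closedBall p₀.1 (ε / 4)} ∈ 𝓝 p₀ :=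
      continuous_fst.continuousAt.preimage_mem_nhds (closedBall_mem_nhds _ (by positivity))
    filter_upwards [hnhds] with p hp
    have hw : (fun q => Y (r p.1) q) = Y p.1 := by rw [hrid p.1 hp]
    rw [globalFlow_suspension_eq hZK hZB (Y' := fun w q => Y (r w) q) (hK p.1) (hB p.1) hw]
  refine ContDiffAt.congr_of_eventuallyEq ?_ hev
  have h2 : ContDiff ℝ n fun p : W × F × ℝ => (((p.2.1, p.1), p.2.2) : (F × W) × ℝ) := by fun_prop
  exact (contDiff_fst.comp (hΛ.comp h2)).contDiffAt

end Literature.Analysis.ODE
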